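import Literature.MathematicalPhysics.QuantumLattice.TIGroundEnergyDensityCouplingFamilies
import Literature.MathematicalPhysics.QuantumLattice.HubbardTTPrimeTPPInteraction
import HarnessLib

/-!
# The `t–t'–t''` Hubbard model AT FIXED FILLING: range-independence of the mean energy, the bridge to
# the certified `t–t'` energy density, and the transport of certified `t–t'` words to `t'' ≠ 0`
# (pencil transport over an arbitrary state class: concavity, signed slope-bracket floors and caps)

Topic `Literature/MathematicalPhysics/QuantumLattice` (family `hubbard`). Companion of
`HubbardTTPrimeTPPInteraction.lean` (the `t–t'–t''` interaction
`hubbardTT'T''FermionInteraction t t' t'' U = Φ(t,t',U) + t''·Φ''(1)`, `‖E_{Φ''(1)}‖_2 ≤ 8`, concavity /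
Lipschitz of the UNCONSTRAINED translation-invariant density `tiGroundEnergyDensity` in `t''`) and of
`TIGroundEnergyDensityCouplingFamilies.lean` (the variational density `infMeanEnergyOn S Ψ R` over a state
class, the FILLING-constrained `tiGroundEnergyDensityAt Ψ R ρ` and its bridge
`tiGroundEnergyDensityAt Φ(t,t',U) 1 ρ = energyDensityTT' t t' U ρ`). Written for stage S2 of the Hubbard
material-oracle programme (D-0096 (ii)): the router's object-M boxes (Wannier Hamiltonian truncated at
printed range) carry `t''/t ≈ 0.04 – 0.18` (La-214, Hg1201), while every certified word of record is a
`t–t'` word at FIXED FILLING `ρ`; the unconstrained density of the companion file is the `μ = 0` point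
only. This file supplies the fixed-filling statements.

* §1 RANGE GLUE (model-free, general `d`): if an interaction has no term `Φ X ≠ 0` with `0 ∈ X`
  outside `thicken {0} R`, its mean-energy observable at any `R' ≥ R` is the embedded one at `R`
  (`FermionInteraction.meanEnergyObs_eq_fermionEmbed_of_le`), so the mean energy of every state
  (`InfVolFermionState.meanEnergy_eq_of_le`) and every variational density (`infMeanEnergyOn_eq_of_le`)
  are INDEPENDENT of the range parameter `R' ≥ R`. Instances: the `t–t'` interaction from `R = 1` up
  (`meanEnergy_hubbardTTPrime_eq_one`), hence
  `tiGroundEnergyDensityAt Φ(t,t',U) R ρ = energyDensityTT' t t' U ρ` for every `R ≥ 1`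
  (`tiGroundEnergyDensityAt_hubbardTTPrime_eq_energyDensityTT'_of_one_le`) and
  `tiGroundEnergyDensity Φ(t,t',U) R = tiGroundEnergyDensity Φ(t,t',U) 1` — which is what makes the
  `R = 2` statements of the companion file statements about the certified `R = 1` objects.
* §2 PENCIL TRANSPORT OVER A STATE CLASS (model-free): for `S` arbitrary and `Ψ₀ + s·Ψ₁`,
  concavity in `s` (`concaveOn_infMeanEnergyOn_pencil`), the SIGNED FLOOR from a class-wide slope
  bracket `e_{Ψ₁}(σ) ∈ [lo, hi]` — `inf_S e_{Ψ₀} + min(s·lo, s·hi) ≤ inf_S e_{Ψ₀+sΨ₁}`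
  (`add_min_le_infMeanEnergyOn_pencil`) — the SIGNED CAP from one state `ω₀ ∈ S` with `e_{Ψ₀}(ω₀) ≤ u`
  and its own slope bracket — `inf_S e_{Ψ₀+sΨ₁} ≤ u + max(s·lo', s·hi')`
  (`infMeanEnergyOn_pencil_le_add_max`) — and the class-constant Lipschitz bound
  (`abs_infMeanEnergyOn_pencil_sub_le`).
* §3 THE `t–t'–t''` MODEL AT FILLING `ρ`: `e_ρ(t,t',t'',U) := tiGroundEnergyDensityAt (Φ(t,t',U) + t''Φ''(1)) 2 ρ`;
  at `t'' = 0` it IS `energyDensityTT' t t' U ρ` (`tiGroundEnergyDensityAt_hubbardTT'T''_zero`, `U ≥ 0`,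
  `0 < ρ < 2`); it is concave in `t''`; and the certified `t–t'` words TRANSPORT:
  - norm form `|e_ρ(t,t',t'',U) − energyDensityTT' t t' U ρ| ≤ 8|t''|`
    (`abs_tiGroundEnergyDensityAt_hubbardTT'T''_sub_energyDensityTT'_le`; honest: `8|t''| = 0.8t` at
    `t''/t = 0.1` — the generic constant is a placeholder, not a usable loss);
  - CERTIFIED-SLOPE FLOOR: a floor `L ≤ energyDensityTT' t t' U ρ` and a bracket `K₃(σ) ∈ [lo₃, hi₃]` on
    the third-neighbour bond density `K₃(σ) = e_{Φ''(1)}(σ)` of every translation-invariant state of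
    density `ρ` give `L + min(t''·lo₃, t''·hi₃) ≤ e_ρ(t,t',t'',U)`
    (`energyDensityTT'_floor_add_min_le_tpp`);
  - CERTIFIED-SLOPE CAP: a translation-invariant state `ω₀` of density `ρ` with `e^{tt'}(ω₀) ≤ u` (a
    torus-limit `t–t'` ground state under a certified cap, or a trial state) and `K₃(ω₀) ∈ [lo₃', hi₃']`
    give `e_ρ(t,t',t'',U) ≤ u + max(t''·lo₃', t''·hi₃')` (`tpp_le_cap_add_max`);
  so a `t''`-box word costs `|t''|` times the WIDTH OF A CERTIFIED `K₃` BRACKET, an SDP objective at the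
  anchor, not `8|t''|`.

Everything is PROVED; no definition, no named fact, no number, no `sorry`. HONEST SCOPE: transport
lemmas; the kinematic (Fermi-sea) bracket `|K₃| ≤ 16/π²`-type constant is NOT proved here; nothing bears
on order or pairing words; `e_ρ(t,t',t'',U)` is the variational (translation-invariant) fixed-filling
density — its identification with a torus thermodynamic limit is proved in the tree at `t'' = 0` only.

## Mathlib / tree search

Tree (REUSED): `FermionInteraction.meanEnergyObs_eq_sum`, `fermionEmbed_fermionEmbed`, `PolySite.incl_trans`,
`thicken_mono`, `pair_[neg_]unitVec_subset_thicken_one`, `pair_[neg_]diagVec_subset_thicken_one`,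
`hubbardTTPrimeFermionInteraction_apply_eq_zero` (support of the `t–t'` terms);
`hubbardTT'T''FermionInteraction_zero`, `InfVolFermionState.meanEnergy_hubbardTT'T''`,
`norm_meanEnergyObs_axialRange2Hopping_le` (`HubbardTTPrimeTPPInteraction`); `infMeanEnergyOn`,
`tiGroundEnergyDensityAt_hubbardTTPrime_eq_energyDensityTT'`, `exists_isTranslationInvariant_density_eq`
(`TIGroundEnergyDensityCouplingFamilies`); `meanEnergy_pencil`, `abs_meanEnergy_le_norm`
(`TIGroundEnergyDensityResponse`). `lean search 'meanEnergy.*eq_of_le|meanEnergyObs_eq_fermionEmbed'`: none.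

## References

* E. Pavarini, I. Dasgupta, T. Saha-Dasgupta, O. Jepsen, O. K. Andersen, Phys. Rev. Lett. 87 (2001)
  047003, eq. (1) (the one-band `t, t', t''` dispersion of the cuprates). [cite: PavariniEtAl2001, eq. (1)]
* O. Bratteli, A. Kishimoto, D. W. Robinson, Commun. Math. Phys. 64 (1978) 41, §3 (the mean energy
  `ω(E_Φ)`, `E_Φ = Σ_{X ∋ 0} Φ(X)/|X|`, does not depend on the ambient local algebra).
  [cite: BratteliKishimotoRobinson1978, §3 (mean energy functional)]
* R. B. Israel, *Convexity in the Theory of Lattice Gases* (1979), Thm. I.3.4. [cite: Israel1979, Thm. I.3.4]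
* R. B. Griffiths, Phys. Rev. 152 (1966) 240, §II. [cite: Griffiths1966, §II]
-/

noncomputable section

namespace Literature.MathematicalPhysics.QuantumLattice

open Matrix Finset HubbardWave0 Literature.Probability.LatticeModels ThermodynamicLimit
open scoped ComplexOrder BigOperators

variable {d : ℕ}

/-! ### §1. Range glue: the mean energy does not depend on the range parameter beyond the range -/

namespace FermionInteraction

/-- **The mean-energy observable at a larger range parameter is the embedded one.** If every term
`Φ X` with `0 ∈ X` and `X ⊄ thicken {0} R` vanishes (e.g. `Φ` of range `≤ R`), then for `R ≤ R'`:
`E_Φ^{(R')} = Γ_{Λ_R ⊆ Λ_{R'}} E_Φ^{(R)}`. [cite: BratteliKishimotoRobinson1978, §3 (mean energy functional)] -/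
theorem meanEnergyObs_eq_fermionEmbed_of_le (Ψ : FermionInteraction d) {R R' : ℝ} (hRR' : R ≤ R')
    (hsupp : ∀ X : Finset (Site d), (0 : Site d) ∈ X → ¬ X ⊆ thicken ({0} : Finset (Site d)) R →
      Ψ.Φ X = 0) :
    Ψ.meanEnergyObs R' =
      fermionEmbed (PolySite.incl (thicken_mono ({0} : Finset (Site d)) hRR')) (Ψ.meanEnergyObs R) := by
  classical
  have hTT' : thicken ({0} : Finset (Site d)) R ⊆ thicken ({0} : Finset (Site d)) R' :=
    thicken_mono _ hRR'
  rw [Ψ.meanEnergyObs_eq_sum R', Ψ.meanEnergyObs_eq_sum R, map_sum]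
  have hA : ((thicken ({0} : Finset (Site d)) R).powerset.filter fun X => (0 : Site d) ∈ X) ⊆
      ((thicken ({0} : Finset (Site d)) R').powerset.filter fun X => (0 : Site d) ∈ X) := by
    intro X hX
    rw [mem_filter, mem_powerset] at hX ⊢
    exact ⟨hX.1.trans hTT', hX.2⟩
  rw [← Finset.sum_subset hA]
  · refine Finset.sum_congr rfl fun X hX => ?_
    rw [mem_filter, mem_powerset] at hX
    rw [dif_pos (hX.1.trans hTT'), dif_pos hX.1, map_smul, fermionEmbed_fermionEmbed, PolySite.incl_trans]
  · intro X hX' hXA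
    rw [mem_filter, mem_powerset] at hX'
    have hXT : ¬ X ⊆ thicken ({0} : Finset (Site d)) R := fun h =>
      hXA (mem_filter.2 ⟨mem_powerset.2 h, hX'.2⟩)
    rw [dif_pos hX'.1, hsupp X hX'.2 hXT, map_zero, smul_zero]

end FermionInteraction

namespace InfVolFermionState

/-- **The mean energy does not depend on the range parameter beyond the support**: under the support
hypothesis of `meanEnergyObs_eq_fermionEmbed_of_le`, `e_Ψ^{(R')}(ω) = e_Ψ^{(R)}(ω)` for every state and
every `R' ≥ R` (compatibility of the state with the isotony embeddings).
[cite: BratteliKishimotoRobinson1978, §3 (mean energy functional)] -/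
theorem meanEnergy_eq_of_le (ω : InfVolFermionState d) (Ψ : FermionInteraction d) {R R' : ℝ}
    (hRR' : R ≤ R')
    (hsupp : ∀ X : Finset (Site d), (0 : Site d) ∈ X → ¬ X ⊆ thicken ({0} : Finset (Site d)) R →
      Ψ.Φ X = 0) :
    ω.meanEnergy Ψ R' = ω.meanEnergy Ψ R := by
  rw [InfVolFermionState.meanEnergy, InfVolFermionState.meanEnergy,
    Ψ.meanEnergyObs_eq_fermionEmbed_of_le hRR' hsupp, ω.compatible]

end InfVolFermionState

namespace FermionInteraction

/-- **Variational densities do not depend on the range parameter beyond the support** (any state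
class). [cite: BratteliKishimotoRobinson1978, §3 (mean energy functional)] -/
theorem infMeanEnergyOn_eq_of_le (S : Set (InfVolFermionState d)) (Ψ : FermionInteraction d)
    {R R' : ℝ} (hRR' : R ≤ R')
    (hsupp : ∀ X : Finset (Site d), (0 : Site d) ∈ X → ¬ X ⊆ thicken ({0} : Finset (Site d)) R →
      Ψ.Φ X = 0) :
    infMeanEnergyOn S Ψ R' = infMeanEnergyOn S Ψ R := by
  unfold infMeanEnergyOn
  exact congrArg sInf (Set.image_congr fun ω _ => ω.meanEnergy_eq_of_le Ψ hRR' hsupp)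

end FermionInteraction

/-! #### The `t–t'` interaction is supported in `thicken {0} 1` -/

section TTPrimeRange

/-- **Support of the `t–t'` terms through the origin**: a term `Φ(t,t',U) X ≠ 0` with `0 ∈ X` has
`X ⊆ [-1,1]²` (singletons, nearest-neighbour and diagonal bonds). [cite: XuEtAl2024, eq. (1)] -/
theorem hubbardTTPrimeFermionInteraction_apply_eq_zero_of_not_subset (t t' U : ℝ) {X : Finset (Site 2)}
    (h0 : (0 : Site 2) ∈ X) (hX : ¬ X ⊆ thicken ({0} : Finset (Site 2)) 1) :
    (hubbardTTPrimeFermionInteraction t t' U).Φ X = 0 := by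
  refine hubbardTTPrimeFermionInteraction_apply_eq_zero t t' U (fun x hx => hX ?_)
    (fun x i hx => hX ?_) (fun x s hx => hX ?_)
  · rw [hx] at h0 ⊢
    rw [mem_singleton] at h0
    rw [← h0]
    exact singleton_subset_iff.2 (zero_mem_thicken_zero 1)
  · rw [hx] at h0 ⊢
    rcases mem_insert.1 h0 with h | h
    · rw [← h]
      exact pair_unitVec_subset_thicken_one i
    · rw [mem_singleton] at h
      rw [eq_neg_of_add_eq_zero_left h.symm]
      exact pair_neg_unitVec_subset_thicken_one i
  · rw [hx] at h0 ⊢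
    rcases mem_insert.1 h0 with h | h
    · rw [← h]
      exact pair_diagVec_subset_thicken_one s
    · rw [mem_singleton] at h
      rw [eq_neg_of_add_eq_zero_left h.symm]
      exact pair_neg_diagVec_subset_thicken_one s

/-- **The `t–t'` mean energy is the same at every range parameter `R ≥ 1`**:
`e_{Φ(t,t',U)}^{(R)}(ω) = e_{Φ(t,t',U)}^{(1)}(ω)`. [cite: BratteliKishimotoRobinson1978, §3 (mean energy functional)] -/
theorem InfVolFermionState.meanEnergy_hubbardTTPrime_eq_one (ω : InfVolFermionState 2) (t t' U : ℝ)
    {R : ℝ} (hR : 1 ≤ R) :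
    ω.meanEnergy (hubbardTTPrimeFermionInteraction t t' U) R =
      ω.meanEnergy (hubbardTTPrimeFermionInteraction t t' U) 1 :=
  ω.meanEnergy_eq_of_le _ hR fun _ h0 hX =>
    hubbardTTPrimeFermionInteraction_apply_eq_zero_of_not_subset t t' U h0 hX

/-- **The unconstrained translation-invariant density of the `t–t'` interaction is the same at every
`R ≥ 1`** — so the `R = 2` statements of `HubbardTTPrimeTPPInteraction` are statements about the
`R = 1` objects of `TIGroundEnergyDensityResponse`. [cite: BratteliKishimotoRobinson1978, Thm. 2 (condition 2)] -/
theorem tiGroundEnergyDensity_hubbardTTPrime_eq_one (t t' U : ℝ) {R : ℝ} (hR : 1 ≤ R) :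
    (hubbardTTPrimeFermionInteraction t t' U).tiGroundEnergyDensity R =
      (hubbardTTPrimeFermionInteraction t t' U).tiGroundEnergyDensity 1 :=
  FermionInteraction.infMeanEnergyOn_eq_of_le _ _ hR fun _ h0 hX =>
    hubbardTTPrimeFermionInteraction_apply_eq_zero_of_not_subset t t' U h0 hX

/-- **The filling-constrained density of the `t–t'` interaction at any `R ≥ 1` is Ruelle's
thermodynamic limit**: `tiGroundEnergyDensityAt Φ(t,t',U) R ρ = energyDensityTT' t t' U ρ` (`U ≥ 0`,
`0 < ρ < 2`). [cite: BratteliKishimotoRobinson1978, Thm. 2] -/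
theorem tiGroundEnergyDensityAt_hubbardTTPrime_eq_energyDensityTT'_of_one_le (t t' : ℝ) {U : ℝ}
    (hU : 0 ≤ U) {R : ℝ} (hR : 1 ≤ R) {ρ : ℝ} (hρ0 : 0 < ρ) (hρ2 : ρ < 2) :
    (hubbardTTPrimeFermionInteraction t t' U).tiGroundEnergyDensityAt R ρ = energyDensityTT' t t' U ρ := by
  rw [← tiGroundEnergyDensityAt_hubbardTTPrime_eq_energyDensityTT' t t' hU hρ0 hρ2,
    FermionInteraction.tiGroundEnergyDensityAt, FermionInteraction.tiGroundEnergyDensityAt]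
  exact FermionInteraction.infMeanEnergyOn_eq_of_le _ _ hR fun _ h0 hX =>
    hubbardTTPrimeFermionInteraction_apply_eq_zero_of_not_subset t t' U h0 hX

end TTPrimeRange

/-! ### §2. Pencil transport over an arbitrary state class -/

namespace FermionInteraction

variable (S : Set (InfVolFermionState d)) (Ψ₀ Ψ₁ : FermionInteraction d) (R : ℝ)

/-- **Concavity along a pencil, any class**: `s ↦ inf_S e_{Ψ₀ + sΨ₁}` is concave on `ℝ` (the class
version of `concaveOn_tiGroundEnergyDensity_pencil`). [cite: Israel1979, Thm. I.3.4] -/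
theorem concaveOn_infMeanEnergyOn_pencil :
    ConcaveOn ℝ Set.univ fun s : ℝ => infMeanEnergyOn S (pencil Ψ₀ Ψ₁ s) R := by
  refine ⟨convex_univ, fun x _ y _ a b ha hb hab => ?_⟩
  rcases S.eq_empty_or_nonempty with rfl | hS
  · simp only [infMeanEnergyOn_empty, smul_zero, add_zero, le_refl]
  refine le_infMeanEnergyOn _ R hS fun ω hω => ?_
  have hx := infMeanEnergyOn_le_meanEnergy (pencil Ψ₀ Ψ₁ x) R hω
  have hy := infMeanEnergyOn_le_meanEnergy (pencil Ψ₀ Ψ₁ y) R hω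
  rw [ω.meanEnergy_pencil] at hx hy ⊢
  simp only [smul_eq_mul]
  have key : ω.meanEnergy Ψ₀ R + (a * x + b * y) * ω.meanEnergy Ψ₁ R =
      a * (ω.meanEnergy Ψ₀ R + x * ω.meanEnergy Ψ₁ R) + b * (ω.meanEnergy Ψ₀ R + y * ω.meanEnergy Ψ₁ R) := by
    linear_combination (-ω.meanEnergy Ψ₀ R) * hab
  rw [key]
  exact add_le_add (mul_le_mul_of_nonneg_left hx ha) (mul_le_mul_of_nonneg_left hy hb)

variable {S}

/-- **SIGNED FLOOR from a class-wide slope bracket.** If `e_{Ψ₁}(σ) ∈ [lo, hi]` for every `σ ∈ S`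
(non-empty), then `inf_S e_{Ψ₀} + min(s·lo, s·hi) ≤ inf_S e_{Ψ₀ + sΨ₁}` for every `s` — a certified
floor at the anchor plus the signed kinematic / certified slope range floors the whole pencil.
[cite: Griffiths1966, §II] -/
theorem add_min_le_infMeanEnergyOn_pencil (hS : S.Nonempty) {lo hi : ℝ}
    (hB : ∀ σ ∈ S, σ.meanEnergy Ψ₁ R ∈ Set.Icc lo hi) (s : ℝ) :
    infMeanEnergyOn S Ψ₀ R + min (s * lo) (s * hi) ≤ infMeanEnergyOn S (pencil Ψ₀ Ψ₁ s) R := by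
  refine le_infMeanEnergyOn _ R hS fun ω hω => ?_
  rw [ω.meanEnergy_pencil]
  have h1 := infMeanEnergyOn_le_meanEnergy Ψ₀ R hω
  have h2 : min (s * lo) (s * hi) ≤ s * ω.meanEnergy Ψ₁ R := by
    rcases le_total 0 s with hs | hs
    · exact (min_le_left _ _).trans (mul_le_mul_of_nonneg_left (hB ω hω).1 hs)
    · exact (min_le_right _ _).trans (mul_le_mul_of_nonpos_left (hB ω hω).2 hs)
  linarith

/-- **Floor form with a certified anchor floor**: `L ≤ inf_S e_{Ψ₀}` and the class-wide bracket give
`L + min(s·lo, s·hi) ≤ inf_S e_{Ψ₀ + sΨ₁}`. [cite: Griffiths1966, §II] -/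
theorem add_min_le_infMeanEnergyOn_pencil_of_le (hS : S.Nonempty) {lo hi L : ℝ}
    (hL : L ≤ infMeanEnergyOn S Ψ₀ R) (hB : ∀ σ ∈ S, σ.meanEnergy Ψ₁ R ∈ Set.Icc lo hi) (s : ℝ) :
    L + min (s * lo) (s * hi) ≤ infMeanEnergyOn S (pencil Ψ₀ Ψ₁ s) R :=
  le_trans (by linarith) (add_min_le_infMeanEnergyOn_pencil Ψ₀ Ψ₁ R hS hB s)

/-- **SIGNED CAP from one state**: `ω₀ ∈ S` with `e_{Ψ₀}(ω₀) ≤ u` and `e_{Ψ₁}(ω₀) ∈ [lo', hi']` gives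
`inf_S e_{Ψ₀ + sΨ₁} ≤ u + max(s·lo', s·hi')` for every `s` (the variational bound with `ω₀`, priced).
[cite: Griffiths1966, §II] -/
theorem infMeanEnergyOn_pencil_le_add_max {ω₀ : InfVolFermionState d} (hω₀ : ω₀ ∈ S) {u : ℝ}
    (hu : ω₀.meanEnergy Ψ₀ R ≤ u) {lo' hi' : ℝ} (hslope : ω₀.meanEnergy Ψ₁ R ∈ Set.Icc lo' hi') (s : ℝ) :
    infMeanEnergyOn S (pencil Ψ₀ Ψ₁ s) R ≤ u + max (s * lo') (s * hi') := by
  refine (infMeanEnergyOn_le_meanEnergy (pencil Ψ₀ Ψ₁ s) R hω₀).trans ?_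
  rw [ω₀.meanEnergy_pencil]
  have h2 : s * ω₀.meanEnergy Ψ₁ R ≤ max (s * lo') (s * hi') := by
    rcases le_total 0 s with hs | hs
    · exact (mul_le_mul_of_nonneg_left hslope.2 hs).trans (le_max_right _ _)
    · exact (mul_le_mul_of_nonpos_left hslope.1 hs).trans (le_max_left _ _)
  linarith

/-- **Class-constant Lipschitz bound along a pencil**: `|e_{Ψ₁}(σ)| ≤ C` on `S` (non-empty) gives
`|inf_S e_{Ψ₀+sΨ₁} − inf_S e_{Ψ₀+s'Ψ₁}| ≤ C|s − s'|`. [cite: Israel1979, Thm. I.3.4] -/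
theorem abs_infMeanEnergyOn_pencil_sub_le (hS : S.Nonempty) {C : ℝ}
    (hC : ∀ σ ∈ S, |σ.meanEnergy Ψ₁ R| ≤ C) (s s' : ℝ) :
    |infMeanEnergyOn S (pencil Ψ₀ Ψ₁ s) R - infMeanEnergyOn S (pencil Ψ₀ Ψ₁ s') R| ≤ C * |s - s'| := by
  have key : ∀ a b : ℝ, infMeanEnergyOn S (pencil Ψ₀ Ψ₁ a) R ≤
      infMeanEnergyOn S (pencil Ψ₀ Ψ₁ b) R + C * |a - b| := by
    intro a b
    rw [← sub_le_iff_le_add]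
    refine le_infMeanEnergyOn _ R hS fun ω hω => ?_
    rw [sub_le_iff_le_add]
    have h1 := infMeanEnergyOn_le_meanEnergy (pencil Ψ₀ Ψ₁ a) R hω
    rw [ω.meanEnergy_pencil_eq_add_sub_mul Ψ₀ Ψ₁ b a R] at h1
    have h3 : (a - b) * ω.meanEnergy Ψ₁ R ≤ C * |a - b| := by
      calc (a - b) * ω.meanEnergy Ψ₁ R ≤ |(a - b) * ω.meanEnergy Ψ₁ R| := le_abs_self _
        _ = |a - b| * |ω.meanEnergy Ψ₁ R| := abs_mul _ _
        _ ≤ |a - b| * C := mul_le_mul_of_nonneg_left (hC ω hω) (abs_nonneg _)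
        _ = C * |a - b| := mul_comm _ _
    linarith
  rw [abs_sub_le_iff]
  constructor
  · linarith [key s s']
  · have h := key s' s
    rw [abs_sub_comm] at h
    linarith

end FermionInteraction

/-! ### §3. The `t–t'–t''` Hubbard model at fixed filling: bridge and transport -/

section TPPFilling

variable (t t' : ℝ)

/-- **At `t'' = 0` the fixed-filling density of the `t–t'–t''` model IS the certified `t–t'` energy
density**: `tiGroundEnergyDensityAt (Φ(t,t',U) + 0·Φ'') 2 ρ = energyDensityTT' t t' U ρ` (`U ≥ 0`,
`0 < ρ < 2`). [cite: PavariniEtAl2001, eq. (1)] -/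
theorem tiGroundEnergyDensityAt_hubbardTT'T''_zero {U : ℝ} (hU : 0 ≤ U) {ρ : ℝ} (hρ0 : 0 < ρ)
    (hρ2 : ρ < 2) :
    (hubbardTT'T''FermionInteraction t t' 0 U).tiGroundEnergyDensityAt 2 ρ = energyDensityTT' t t' U ρ := by
  rw [hubbardTT'T''FermionInteraction_zero]
  exact tiGroundEnergyDensityAt_hubbardTTPrime_eq_energyDensityTT'_of_one_le t t' hU (by norm_num) hρ0 hρ2

/-- **The fixed-filling density is concave in `t''`** (every `ρ`, every range parameter).
[cite: Israel1979, Thm. I.3.4] -/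
theorem concaveOn_tiGroundEnergyDensityAt_tpp (U R ρ : ℝ) :
    ConcaveOn ℝ Set.univ fun t'' : ℝ => (hubbardTT'T''FermionInteraction t t' t'' U).tiGroundEnergyDensityAt R ρ :=
  FermionInteraction.concaveOn_infMeanEnergyOn_pencil _ _ _ R

open scoped Matrix.Norms.L2Operator in
/-- **The third-neighbour bond density is normed by `8`** (range parameter `2`): `|K₃(ω)| ≤ 8` for every
state, `K₃(ω) = e_{Φ''(1)}(ω)`. [cite: BratteliRobinsonI1987, Prop. 2.3.11] -/
theorem InfVolFermionState.abs_meanEnergy_axialRange2Hopping_one_le_eight (ω : InfVolFermionState 2) :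
    |ω.meanEnergy (axialRange2HoppingFermionInteraction 2 1) 2| ≤ 8 := by
  refine (ω.abs_meanEnergy_le_norm _ 2).trans ?_
  have h := norm_meanEnergyObs_axialRange2Hopping_le (d := 2) (1 : ℝ)
  rw [abs_one, mul_one, Nat.cast_ofNat] at h
  linarith

/-- **Lipschitz in `t''` at fixed filling with the generic constant**:
`|e_ρ(t,t',t'',U) − e_ρ(t,t',s'',U)| ≤ 8|t'' − s''|` (range parameter `2`; every realised `ρ`).
[cite: Israel1979, Thm. I.3.4] -/
theorem abs_tiGroundEnergyDensityAt_tpp_sub_le_eight_mul (U : ℝ) {ρ : ℝ} (hρ0 : 0 < ρ) (hρ2 : ρ < 2)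
    (t'' s'' : ℝ) :
    |(hubbardTT'T''FermionInteraction t t' t'' U).tiGroundEnergyDensityAt 2 ρ -
        (hubbardTT'T''FermionInteraction t t' s'' U).tiGroundEnergyDensityAt 2 ρ| ≤ 8 * |t'' - s''| := by
  obtain ⟨ω, hω, hρ⟩ := exists_isTranslationInvariant_density_eq hρ0 hρ2
  exact FermionInteraction.abs_infMeanEnergyOn_pencil_sub_le _ _ 2
    (S := {ω : InfVolFermionState 2 | ω.IsTranslationInvariant ∧ ω.density = ρ}) ⟨ω, ⟨hω, hρ⟩⟩
    (fun σ _ => σ.abs_meanEnergy_axialRange2Hopping_one_le_eight) t'' s''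

/-- **TRANSPORT OF THE CERTIFIED `t–t'` DENSITY TO `t'' ≠ 0`, norm form**:
`|e_ρ(t,t',t'',U) − energyDensityTT' t t' U ρ| ≤ 8|t''|` (`U ≥ 0`, `0 < ρ < 2`). Honest: the
generic constant `8` is a placeholder (`0.8t` at `t''/t = 0.1`); the usable losses are the certified-slope
forms below. [cite: Israel1979, Thm. I.3.4] -/
theorem abs_tiGroundEnergyDensityAt_hubbardTT'T''_sub_energyDensityTT'_le {U : ℝ} (hU : 0 ≤ U) {ρ : ℝ}
    (hρ0 : 0 < ρ) (hρ2 : ρ < 2) (t'' : ℝ) :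
    |(hubbardTT'T''FermionInteraction t t' t'' U).tiGroundEnergyDensityAt 2 ρ - energyDensityTT' t t' U ρ| ≤
      8 * |t''| := by
  have h := abs_tiGroundEnergyDensityAt_tpp_sub_le_eight_mul t t' U hρ0 hρ2 t'' 0
  rwa [tiGroundEnergyDensityAt_hubbardTT'T''_zero t t' hU hρ0 hρ2, sub_zero] at h

/-- **CERTIFIED-SLOPE FLOOR in `t''`.** A certified floor `L ≤ energyDensityTT' t t' U ρ` and a bracket
`K₃(σ) ∈ [lo₃, hi₃]` on the third-neighbour bond density of EVERY translation-invariant state of density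
`ρ` (kinematic, or a certified class-wide word) give, for every `t''`:
`L + min(t''·lo₃, t''·hi₃) ≤ e_ρ(t,t',t'',U)` (`U ≥ 0`, `0 < ρ < 2`). [cite: Griffiths1966, §II] -/
theorem energyDensityTT'_floor_add_min_le_tpp {U : ℝ} (hU : 0 ≤ U) {ρ : ℝ} (hρ0 : 0 < ρ) (hρ2 : ρ < 2)
    {L : ℝ} (hL : L ≤ energyDensityTT' t t' U ρ) {lo₃ hi₃ : ℝ}
    (hB : ∀ σ : InfVolFermionState 2, σ.IsTranslationInvariant → σ.density = ρ →
      σ.meanEnergy (axialRange2HoppingFermionInteraction 2 1) 2 ∈ Set.Icc lo₃ hi₃) (t'' : ℝ) :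
    L + min (t'' * lo₃) (t'' * hi₃) ≤ (hubbardTT'T''FermionInteraction t t' t'' U).tiGroundEnergyDensityAt 2 ρ := by
  obtain ⟨ω, hω, hρ⟩ := exists_isTranslationInvariant_density_eq hρ0 hρ2
  rw [← tiGroundEnergyDensityAt_hubbardTTPrime_eq_energyDensityTT'_of_one_le t t' hU (by norm_num : (1:ℝ) ≤ 2)
    hρ0 hρ2] at hL
  exact FermionInteraction.add_min_le_infMeanEnergyOn_pencil_of_le _ _ 2
    (S := {ω : InfVolFermionState 2 | ω.IsTranslationInvariant ∧ ω.density = ρ}) ⟨ω, ⟨hω, hρ⟩⟩ hL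
    (fun σ hσ => hB σ hσ.1 hσ.2) t''

/-- **CERTIFIED-SLOPE CAP in `t''`.** A translation-invariant state `ω₀` of density `ρ` with
`e^{tt'}(ω₀) ≤ u` (range parameter `2`; e.g. a torus-limit `t–t'` ground state under a certified cap `u`,
or a trial state) and `K₃(ω₀) ∈ [lo₃', hi₃']` gives, for every `t''`:
`e_ρ(t,t',t'',U) ≤ u + max(t''·lo₃', t''·hi₃')`. [cite: Griffiths1966, §II] -/
theorem tpp_le_cap_add_max (U : ℝ) {ρ : ℝ} {ω₀ : InfVolFermionState 2} (hω₀ : ω₀.IsTranslationInvariant)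
    (hρ : ω₀.density = ρ) {u : ℝ} (hu : ω₀.meanEnergy (hubbardTTPrimeFermionInteraction t t' U) 2 ≤ u)
    {lo₃' hi₃' : ℝ} (hslope : ω₀.meanEnergy (axialRange2HoppingFermionInteraction 2 1) 2 ∈ Set.Icc lo₃' hi₃')
    (t'' : ℝ) :
    (hubbardTT'T''FermionInteraction t t' t'' U).tiGroundEnergyDensityAt 2 ρ ≤ u + max (t'' * lo₃') (t'' * hi₃') :=
  FermionInteraction.infMeanEnergyOn_pencil_le_add_max _ _ 2
    (S := {ω : InfVolFermionState 2 | ω.IsTranslationInvariant ∧ ω.density = ρ}) ⟨hω₀, hρ⟩ hu hslope t''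

/-- The cap hypothesis at range parameter `1` (the form in which the `t–t'` caps are certified):
`e^{tt'}(ω₀)` at `R = 2` equals the one at `R = 1`. [cite: Griffiths1966, §II] -/
theorem tpp_le_cap_add_max_of_one (U : ℝ) {ρ : ℝ} {ω₀ : InfVolFermionState 2}
    (hω₀ : ω₀.IsTranslationInvariant) (hρ : ω₀.density = ρ) {u : ℝ}
    (hu : ω₀.meanEnergy (hubbardTTPrimeFermionInteraction t t' U) 1 ≤ u)
    {lo₃' hi₃' : ℝ} (hslope : ω₀.meanEnergy (axialRange2HoppingFermionInteraction 2 1) 2 ∈ Set.Icc lo₃' hi₃')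
    (t'' : ℝ) :
    (hubbardTT'T''FermionInteraction t t' t'' U).tiGroundEnergyDensityAt 2 ρ ≤ u + max (t'' * lo₃') (t'' * hi₃') :=
  tpp_le_cap_add_max t t' U hω₀ hρ
    (by rwa [ω₀.meanEnergy_hubbardTTPrime_eq_one t t' U (by norm_num : (1:ℝ) ≤ 2)]) hslope t''

/-- **Two-sided `t''`-window at fixed filling from `t–t'` data**: floor `L`, class-wide bracket
`[lo₃, hi₃]`, a capped anchor state `ω₀` (`e^{tt'}(ω₀) ≤ u` at `R = 1`) with slope bracket `[lo₃', hi₃']`: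
`e_ρ(t,t',t'',U) ∈ [L + min(t''lo₃, t''hi₃), u + max(t''lo₃', t''hi₃')]`. [cite: Griffiths1966, §II] -/
theorem tiGroundEnergyDensityAt_tpp_mem_Icc {U : ℝ} (hU : 0 ≤ U) {ρ : ℝ} (hρ0 : 0 < ρ) (hρ2 : ρ < 2)
    {L : ℝ} (hL : L ≤ energyDensityTT' t t' U ρ) {lo₃ hi₃ : ℝ}
    (hB : ∀ σ : InfVolFermionState 2, σ.IsTranslationInvariant → σ.density = ρ →
      σ.meanEnergy (axialRange2HoppingFermionInteraction 2 1) 2 ∈ Set.Icc lo₃ hi₃)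
    {ω₀ : InfVolFermionState 2} (hω₀ : ω₀.IsTranslationInvariant) (hρ : ω₀.density = ρ) {u : ℝ}
    (hu : ω₀.meanEnergy (hubbardTTPrimeFermionInteraction t t' U) 1 ≤ u) {lo₃' hi₃' : ℝ}
    (hslope : ω₀.meanEnergy (axialRange2HoppingFermionInteraction 2 1) 2 ∈ Set.Icc lo₃' hi₃') (t'' : ℝ) :
    (hubbardTT'T''FermionInteraction t t' t'' U).tiGroundEnergyDensityAt 2 ρ ∈
      Set.Icc (L + min (t'' * lo₃) (t'' * hi₃)) (u + max (t'' * lo₃') (t'' * hi₃')) :=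
  ⟨energyDensityTT'_floor_add_min_le_tpp t t' hU hρ0 hρ2 hL hB t'',
    tpp_le_cap_add_max_of_one t t' U hω₀ hρ hu hslope t''⟩

end TPPFilling

end Literature.MathematicalPhysics.QuantumLattice

end
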